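import Mathlib
import HarnessLib
import Literature.MathematicalPhysics.KineticTheory.VelocityFlipEmbeddedChainSteadyState
import Summits.AtomisticToContinuum.FouriersLaw.Theorems.VanishingNoiseTransferVanishingNoiseBoundUniformLyapunov

/-!
# The resolvent Lyapunov bound of the pinned chain with constants UNIFORM in the bath temperatures
(helper for stub CONT `stub_flipMildContinuity`, line `fekete-usc-one-length`, crux stmt-AtomisticToContinuum-11976)

`--supports stmt-AtomisticToContinuum-11976` helper file (crux `VanishingNoiseBound`, route `VanishingNoiseTransfer`,
line `fekete-usc-one-length`, stub CONT, wave 5). The contracting Lyapunov bound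
`∫ e^{θH} dR_r(z,·) ≤ a e^{θH(z)} + b` (`a < 1`, `b < ∞`) of the resolvent kernel `R_r` of the flip-free dynamics of
`pinnedChain ω₂ lam β γ` is in the tree at FIXED bath temperatures
(`pinnedChain_lintegral_exp_hamiltonian_resolventKernel_le`, `VelocityFlipEmbeddedChainSteadyState.lean`), the energy
threshold `E₀` of CEHR Thm 5.1 being produced per pair of temperatures. Here the same computation is re-run with the
temperature-uniform threshold of `pinnedChain_lintegral_exp_hamiltonian_small_uniform` (`…UniformLyapunov.lean`) and
the (3.4) rate frozen at `2θγT_max`: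

* `pinnedChain_resolvent_lyapunov_uniform` — for `0 < θ < 1/T_max` and `r > 0` there are `a < 1`, `b < ∞` such that
  `∫ e^{θH} dR_r(z,·) ≤ a e^{θH(z)} + b` for ALL bath temperatures `0 < T_L, T_R ≤ T_max` (same `a, b`).
* `pinnedChain_resolvent_lyapunov_uniform'` — the same with `ℝ≥0` constants and the weight `(e^{θH}).toNNReal`.
* `helper_flipMildContinuityLyapunov` — registered helper (notation-free restatement).

References: Cuneo–Eckmann–Hairer–Rey-Bellet 2018 §3 (3.4)–(3.6), Thm 5.1, Rem 5.2; Ethier–Kurtz 1986 Ch. 1 §2.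
-/

noncomputable section

open MeasureTheory ProbabilityTheory Filter Topology Set
open scoped NNReal ENNReal Topology
open Literature.MathematicalPhysics.KineticTheory.HeatConduction Literature.Probability.Process OscillatorChain
open Summit.AtomisticToContinuum.FouriersLaw.Theorems.FixedLengthNoiseContinuity
  (pinnedChain_lintegral_exp_hamiltonian_small_uniform)

namespace Summit.AtomisticToContinuum.FouriersLaw.Theorems.VanishingNoiseBound

variable {ω₂ lam β γ : ℝ} {N : ℕ}

set_option maxHeartbeats 800000 in
/-- **Contracting Lyapunov bound for the resolvent kernel, uniform in the bath temperatures** (`ω₂, lam, β, γ > 0`,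
`N ≥ 2`, `r > 0`, `0 < θ < 1/T_max`): there are `a < 1`, `b ≠ ∞` with `∫ e^{θH} dR_r(z, ·) ≤ a e^{θH(z)} + b` for
every `z` and ALL bath temperatures `0 < T_L, T_R ≤ T_max`. Proof of
`pinnedChain_lintegral_exp_hamiltonian_resolventKernel_le` verbatim with `C = 2θγT_max` (dominating the (3.4) rate
`θγ(T_L+T_R)`), `t* = 1/(8(C + r + 1))`, and the uniform H2 threshold `E₀` of
`pinnedChain_lintegral_exp_hamiltonian_small_uniform`. [cite: CuneoEckmannHairerReyBellet2018, Thm 5.1 and §3 (3.4)–(3.6)] -/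
theorem pinnedChain_resolvent_lyapunov_uniform (hω : 0 < ω₂) (hl : 0 < lam) (hβ : 0 < β) (hγ : 0 < γ)
    (hN : 1 < N) {Tmax θ r : ℝ} (hTmax : 0 < Tmax) (hθ : 0 < θ) (hθ' : θ < 1 / Tmax) (hr : 0 < r) :
    ∃ a b : ℝ≥0∞, a < 1 ∧ b ≠ ⊤ ∧ ∀ (T_L T_R : ℝ) (hTL : 0 < T_L) (hTR : 0 < T_R), T_L ≤ Tmax → T_R ≤ Tmax →
      ∀ z : PhaseSpace N,
        ∫⁻ y, ENNReal.ofReal (Real.exp (θ * (pinnedChain ω₂ lam β γ).hamiltonian N y))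
            ∂((pinnedChainSemigroup hω hl.le hβ.le hγ.le (Nat.zero_lt_of_lt hN) hTL.le
                hTR.le).resolventKernel r z) ≤
          a * ENNReal.ofReal (Real.exp (θ * (pinnedChain ω₂ lam β γ).hamiltonian N z)) + b := by
  -- adapted from `pinnedChain_lintegral_exp_hamiltonian_resolventKernel_le`
  -- (Literature/MathematicalPhysics/KineticTheory/VelocityFlipEmbeddedChainSteadyState.lean)
  have hN0 : 0 < N := Nat.zero_lt_of_lt hN
  set P := pinnedChain ω₂ lam β γ with hP
  haveI := isProbabilityMeasure_expMeasure hr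
  set ρ := expMeasure r with hρ
  -- the frozen (3.4) rate and the time step
  set Cst : ℝ := θ * γ * (Tmax + Tmax) with hCst
  have hCst0 : 0 ≤ Cst := by positivity
  set ts : ℝ := 1 / (8 * (Cst + r + 1)) with hts
  have hts0 : 0 < ts := by positivity
  have hkey : (Cst + r + 1) * ts = 1 / 8 := by rw [hts]; field_simp
  have hCts : Cst * ts ≤ 1 / 8 := hkey ▸ mul_le_mul_of_nonneg_right (by linarith) hts0.le
  have hrts : r * ts ≤ 1 / 8 := hkey ▸ mul_le_mul_of_nonneg_right (by linarith) hts0.le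
  set tstar : ℝ≥0 := ⟨ts, hts0.le⟩ with htstar
  have htsco : ((tstar : ℝ≥0) : ℝ) = ts := rfl
  have hts0' : (0 : ℝ≥0) < tstar := by rw [← NNReal.coe_lt_coe]; exact hts0
  set V : PhaseSpace N → ℝ≥0∞ := fun y => ENNReal.ofReal (Real.exp (θ * P.hamiltonian N y)) with hV
  have hVm : Measurable V := ENNReal.measurable_ofReal.comp (Real.measurable_exp.comp
    ((pinnedChain_continuous_hamiltonian ω₂ lam β γ N).measurable.const_mul _))
  -- the uniform H2 threshold at `t*` (contraction `1/2`)
  obtain ⟨E₀, hE₀⟩ := pinnedChain_lintegral_exp_hamiltonian_small_uniform (N := N) hω hl hβ hγ hN hθ hTmax hθ'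
    (tstar := (tstar : ℝ)) (by rw [htsco]; exact hts0)
  set c₀ : ℝ := Real.exp (Cst * ts) * Real.exp (θ * E₀) with hc₀
  set a₀ : ℝ≥0∞ := ENNReal.ofReal (1 / 2) with ha₀
  have ha₀1 : a₀ < 1 := ENNReal.ofReal_lt_one.2 (by norm_num)
  obtain ⟨B, hBtop, hB⟩ := MarkovSemigroup.exists_fixedBound ha₀1 (ENNReal.ofReal_ne_top (r := c₀))
  set c : ℝ≥0∞ := ENNReal.ofReal (Real.exp (Cst * ts)) with hc
  refine ⟨c * ENNReal.ofReal (r * ts) + c * a₀, B + (c * ENNReal.ofReal c₀ + B), ?_, ?_,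
    fun T_L T_R hTL hTR hLmax hRmax z => ?_⟩
  · rw [hc, ha₀, ← ENNReal.ofReal_mul (Real.exp_pos _).le,
      ← ENNReal.ofReal_mul (Real.exp_pos _).le, ← ENNReal.ofReal_add (by positivity) (by positivity),
      ENNReal.ofReal_lt_one]
    have h1 : Real.exp (Cst * ts) * (1 - Cst * ts) ≤ 1 := by
      have := Real.add_one_le_exp (-(Cst * ts))
      calc Real.exp (Cst * ts) * (1 - Cst * ts)
          ≤ Real.exp (Cst * ts) * Real.exp (-(Cst * ts)) :=
            mul_le_mul_of_nonneg_left (by linarith) (Real.exp_pos _).le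
        _ = 1 := by rw [← Real.exp_add, add_neg_cancel, Real.exp_zero]
    nlinarith [Real.exp_pos (Cst * ts), mul_nonneg hCst0 hts0.le, mul_nonneg hr.le hts0.le]
  · exact ENNReal.add_ne_top.2 ⟨hBtop, ENNReal.add_ne_top.2
      ⟨ENNReal.mul_ne_top ENNReal.ofReal_ne_top ENNReal.ofReal_ne_top, hBtop⟩⟩
  · set Sg := pinnedChainSemigroup hω hl.le hβ.le hγ.le hN0 hTL.le hTR.le with hSg
    have hK : ∀ (t : ℝ) (z : PhaseSpace N), Sg.timeKernel (t, z) = Sg.kernel t.toNNReal z :=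
      fun t z => rfl
    have hmax : max T_L T_R ≤ Tmax := max_le hLmax hRmax
    have hθ'' : θ < 1 / max T_L T_R :=
      hθ'.trans_le (one_div_le_one_div_of_le (lt_max_of_lt_left hTL) hmax)
    have h34 : ∀ (t : ℝ≥0) (x : PhaseSpace N), ∫⁻ y, V y ∂(Sg.kernel t x) ≤
        ENNReal.ofReal (Real.exp (Cst * t) * Real.exp (θ * P.hamiltonian N x)) := by
      intro t x
      refine (lintegral_exp_mul_hamiltonian_pinnedChainSemigroup_le hω hl.le hβ.le hγ.le hN0 hTL.le
        hTR.le hTL hTR hθ hθ'' t x).trans (ENNReal.ofReal_le_ofReal ?_)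
      refine mul_le_mul_of_nonneg_right (Real.exp_le_exp.2 (mul_le_mul_of_nonneg_right ?_ t.coe_nonneg))
        (Real.exp_pos _).le
      rw [hCst]
      exact mul_le_mul_of_nonneg_left (add_le_add hLmax hRmax) (by positivity)
    -- H2 at `t*`
    have hH2 : ∀ x, ∫⁻ y, V y ∂(Sg.kernel tstar x) ≤ a₀ * V x + ENNReal.ofReal c₀ := by
      intro x
      by_cases hx : P.hamiltonian N x ≤ E₀
      · refine (h34 tstar x).trans (le_add_left (ENNReal.ofReal_le_ofReal ?_))
        rw [hc₀, htsco]
        exact mul_le_mul_of_nonneg_left (Real.exp_le_exp.2 (mul_le_mul_of_nonneg_left hx hθ.le))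
          (Real.exp_pos _).le
      · change ∫⁻ y, V y ∂(P.transitionKernel N T_L T_R tstar x) ≤ _
        rw [pinnedChain_lintegral_transitionKernel hω hl.le hβ.le hγ.le N T_L T_R tstar x hVm]
        refine (hE₀ T_L T_R hTL hTR hLmax hRmax x (le_of_not_ge hx)).trans (le_add_right (le_of_eq ?_))
        rw [ha₀, hV, ← ENNReal.ofReal_mul (by norm_num)]
        congr 1; ring
    have hloc : ∀ u : ℝ≥0, u < tstar → ∀ x, ∫⁻ y, V y ∂(Sg.kernel u x) ≤ c * V x := by
      intro u hu x
      refine (h34 u x).trans ?_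
      rw [hc, hV, ← ENNReal.ofReal_mul (by positivity)]
      refine ENNReal.ofReal_le_ofReal (mul_le_mul_of_nonneg_right (Real.exp_le_exp.2 ?_) (by positivity))
      have hu' : ((u : ℝ≥0) : ℝ) ≤ ts := by rw [← htsco]; exact_mod_cast hu.le
      nlinarith [u.coe_nonneg]
    have hunif : ∀ (t : ℝ≥0) x, ∫⁻ y, V y ∂(Sg.kernel t x) ≤ c * V x + B := fun t x =>
      MarkovSemigroup.lintegral_kernel_le_of_lyapunov Sg.kernel Sg.kernel_zero Sg.kernel_add hVm hts0'
        ha₀1.le hB hH2 hloc t x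
    have h₁ : ∀ t : ℝ, ∫⁻ y, V y ∂(Sg.timeKernel (t, z)) ≤ c * V z + B := fun t =>
      hunif t.toNNReal z
    have h₂ : ∀ t : ℝ, ts ≤ t →
        ∫⁻ y, V y ∂(Sg.timeKernel (t, z)) ≤ c * a₀ * V z + (c * ENNReal.ofReal c₀ + B) :=
      fun t ht => Sg.lintegral_kernel_le_of_tstar_le Sg.timeKernel hK hVm hH2 hunif
        (by rw [htsco]; exact ht) z
    rw [LangevinChainSemigroup.resolventKernel_eq]
    refine (lintegral_comp_const_prod_id_le Sg.timeKernel ρ z hVm ts h₁ h₂).trans ?_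
    gcongr
    exact expMeasure_Iio_le hr hts0.le

/-- **The uniform resolvent Lyapunov bound with `ℝ≥0` constants** for the weight `V = (e^{θH}).toNNReal`:
`∫⁻ V dR_r(z,·) ≤ γ₀ V(z) + K₀` with `γ₀ < 1`, the same `(γ₀, K₀)` for all `0 < T_L, T_R ≤ T_max`.
[cite: CuneoEckmannHairerReyBellet2018, Thm 5.1 and §3 (3.4)–(3.6)] -/
theorem pinnedChain_resolvent_lyapunov_uniform' (hω : 0 < ω₂) (hl : 0 < lam) (hβ : 0 < β) (hγ : 0 < γ)
    (hN : 1 < N) {Tmax θ r : ℝ} (hTmax : 0 < Tmax) (hθ : 0 < θ) (hθ' : θ < 1 / Tmax) (hr : 0 < r) :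
    ∃ γ₀ K₀ : ℝ≥0, γ₀ < 1 ∧ ∀ (T_L T_R : ℝ) (hTL : 0 < T_L) (hTR : 0 < T_R), T_L ≤ Tmax → T_R ≤ Tmax →
      ∀ z : PhaseSpace N,
        ∫⁻ y, ((Real.exp (θ * (pinnedChain ω₂ lam β γ).hamiltonian N y)).toNNReal : ℝ≥0∞)
            ∂((pinnedChainSemigroup hω hl.le hβ.le hγ.le (Nat.zero_lt_of_lt hN) hTL.le
                hTR.le).resolventKernel r z) ≤
          (γ₀ : ℝ≥0∞) * ((Real.exp (θ * (pinnedChain ω₂ lam β γ).hamiltonian N z)).toNNReal : ℝ≥0∞) + K₀ := by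
  obtain ⟨a, b, ha, hb, h⟩ := pinnedChain_resolvent_lyapunov_uniform hω hl hβ hγ hN hTmax hθ hθ' hr
  lift a to ℝ≥0 using (ha.trans_le le_top).ne with γ₀ hγ₀
  lift b to ℝ≥0 using hb with K₀ hK₀
  exact ⟨γ₀, K₀, by exact_mod_cast ha, fun T_L T_R hTL hTR h1 h2 z => h T_L T_R hTL hTR h1 h2 z⟩

/-! ## Registered helper -/

/-- Registered helper sub-goal `helper_flipMildContinuityLyapunov` of stub `stub_flipMildContinuity` (line
`fekete-usc-one-length`, crux stmt-AtomisticToContinuum-11976): the temperature-uniform resolvent Lyapunov bound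
`pinnedChain_resolvent_lyapunov_uniform` (notation-free one-line form). -/
theorem helper_flipMildContinuityLyapunov : ∀ (ω₂ lam β γ : ℝ) (hω : 0 < ω₂) (hl : 0 < lam) (hβ : 0 < β) (hγ : 0 < γ) (N : ℕ) (hN : 1 < N) (Tmax θ r : ℝ), 0 < Tmax → 0 < θ → θ < 1 / Tmax → 0 < r → ∃ a b : ENNReal, a < 1 ∧ b ≠ (⊤ : ENNReal) ∧ ∀ (T_L T_R : ℝ) (hTL : 0 < T_L) (hTR : 0 < T_R), T_L ≤ Tmax → T_R ≤ Tmax → ∀ z : Literature.MathematicalPhysics.KineticTheory.HeatConduction.PhaseSpace N, MeasureTheory.lintegral ((Literature.MathematicalPhysics.KineticTheory.HeatConduction.pinnedChainSemigroup hω (le_of_lt hl) (le_of_lt hβ) (le_of_lt hγ) (Nat.zero_lt_of_lt hN) (le_of_lt hTL) (le_of_lt hTR)).resolventKernel r z) (fun y => ENNReal.ofReal (Real.exp (θ * (Literature.MathematicalPhysics.KineticTheory.HeatConduction.pinnedChain ω₂ lam β γ).hamiltonian N y))) ≤ a * ENNReal.ofReal (Real.exp (θ * (Literature.MathematicalPhysics.KineticTheory.HeatConduction.pinnedChain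 ω₂ lam β γ).hamiltonian N z)) + b :=
  fun _ _ _ _ hω hl hβ hγ _ hN _ _ _ hTmax hθ hθ' hr =>
    pinnedChain_resolvent_lyapunov_uniform hω hl hβ hγ hN hTmax hθ hθ' hr

end Summit.AtomisticToContinuum.FouriersLaw.Theorems.VanishingNoiseBound

end
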